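import Summits.BirchSwinnertonDyer.BirchSwinnertonDyer.Theses.UniversalToricDescent
import Summits.BirchSwinnertonDyer.BirchSwinnertonDyer.Theorems.UniversalToricDescentToricTransportModThreeStubRatSqueeze
import Summits.BirchSwinnertonDyer.BirchSwinnertonDyer.Theorems.UniversalToricDescentAdditiveSplitIMCInclusionAtThreeStubFrame
import Summits.BirchSwinnertonDyer.BirchSwinnertonDyer.Theorems.UniversalToricDescentThinCombContRigidity
import Literature.NumberTheory.EllipticCurves.ToricTwoVariablePAdicLFunction
import Literature.NumberTheory.GaloisRepresentations.AbsGaloisGroup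
import HarnessLib

/-!
# NODE `unramified_coleman_axis` — crux `AdditiveSplitIMCInclusionAtThree` (stmt-BirchSwinnertonDyer-20395, THE WALL, UTD)
# crux-ideate round 25 (unit cruxidea-stmt-BirchSwinnertonDyer-20395-1-g25), 2026-08-31

NODE for the crux idea `unramified-coleman-axis` (card `Ideas/unramified-coleman-axis.md`, line card
`Lines/unramified_coleman_axis.md`).  Conventions (tree, checked): `AcSelmer.XAc E 3 κ 𝔮 ∅ γ` is Castella's
`X = Sel_𝔮(K_{κ,∞}, E[3^∞])^∨` — STRICT at the named prime `𝔮`, NO condition at the other prime above `3`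
(`AcSelmer.selmerOver`, Cas18 Def. 2.2); the crux's module `XAc (E_K) 3 κ 𝔭' ∅ γ` is `X_(∅ at 𝔭, 0 at 𝔭′)` on the
anticyclotomic line, `𝔭` = the BDP branch prime.  In the LEAD's `thin_comb` frame (`stub_frame`, landed) `κ₁` is THE
`ℤ₃`-line of `K` unramified outside `𝔭` (the `𝔭`-AXIS; outer variable `T₁ ↔ γ₁`), and the toric two-variable function
`L₂ ∈ Λ₂(R₀) = R₀⟦T₂⟧⟦T₁⟧` of branch `𝔭` (K3a) restricts to the `𝔭`-axis by `T₂ ↦ 0` (`axisRestrict`).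

THE LINE.  By the g7 structural theorem `wall_iff_ratwall_and_muDominance` the wall is RATWALL (24207, LEAD) plus the
`μ`-half; this node supplies the `μ`-half from an EULER SYSTEM READ AT THE PRIME THAT IS UNRAMIFIED IN A `ℤ₃`-LINE:
* S2 `AxisMuAnalytic` — the `𝔭`-axis is not an exceptional line of `L₂ mod 3`: `3 ∤ L₂(T₁, 0)` in `R₀⟦T₁⟧`
  (UNDECIDED · INSTRUMENTABLE · ATTACKABLE-adjacent: Hida–Hsieh toric-form density along the `𝔭`-power-conductor direction).
* S3 `UnramifiedColemanBound` — THE ENGINE (UNDECIDED, research of known type): on the `𝔭`-axis the one-variable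
  Beilinson–Flach class of `f_E` (FIXED, any level, any slope) against the CM Hida family of `𝔭`-power conductor lies in the
  core-rank-one structure `(∅ at 𝔭, f at 𝔭′)`; the prime `𝔭′` is UNRAMIFIED in `K_{κ₁,∞}` and `E/ℚ₃` is additive with
  `e(K_{κ₁,n,𝔭′}/ℚ₃) = 1 < p − 1`, so `log_{ω_f} : E₀(K_{κ₁,n,𝔭′}) ⊗ ℤ₃ ⥲ 𝒪_n` (index count `[𝒪_n : 𝔪_n] = #𝔾_a(k_n)`)
  and the normal integral basis give an INTEGRAL, `μ`-EXACT Coleman coordinate `H¹_{f,Iw}(K_𝔭′, T₃E) ≅ Λ` needing no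
  `D_cris`, no `±`, no filtration on `f`; Kolyvagin-system bound WITH the `p`-part (Howard 2.2.10 / MR 5.3.10 shape) plus ONE
  Poitou–Tate local term give `Ch_Λ X_(0 at 𝔭, ∅ at 𝔭′)(κ₁) ∣ (e·P_κ)^{c+1}` with `μ(P_κ) ≤ μ(L₂(T₁,0))`, where the local index
  `P_κ` is identified with `L₂(T₁,0)` up to a `μ`-free factor `e` by the `g`-dominant reciprocity law (`ω_f ⊗ η_𝐠`,
  unit root `λ(𝔭′)`).  Leaves: BF axis class at `3² ∣ N_f` keeping the `c`-factor (ATTACKABLE-from-print, LLZ15 §5.3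
  «`p ∤ N_f` largely for convenience»); unramified integral Coleman map (PROVABLE); KS machine over `K_{κ₁,∞}` at `p = 3`
  (ATTACKABLE for `3`-adically large image, BARRIER-adjacent `EulerSystemBigImageAtSmallImage` on Elkies rows);
  `g`-dominant reciprocity law for `f` of wild level read by `log_{ω_f}` (IDEA-NEEDED; Kato's any-level dual-exponential law +
  Rankin–Selberg unfolding is the named candidate).
* S4 `AxisToAnticyclotomic` — TRANSFER (UNDECIDED · ATTACKABLE under the LEAD's two-variable inputs): complex conjugation
  carries `(X_(0 at 𝔭, ∅ at 𝔭′), 𝔭-axis)` to `(X_(∅ at 𝔭, 0 at 𝔭′), 𝔭′-axis)`; specialisation can only RAISE `μ`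
  (`Ch_Λ(X₂/ℓX₂) = π_ℓ(Ch_{Λ₂} X₂)` for `pd ≤ 1`, i.e. NoPN) and control at the `𝔭′`-axis is finite, so
  `μ₂(X₂) ≤ μ(axis) = 0`; and `μ_ac(X) = μ₂(X₂)` EXACTLY under K2-rat₂ + Hsieh + NoPN + control (remark R-g18-1).
* S1 `stub_toricExists` VERBATIM K3a (shared with `thin_comb` v8.1 / `nakayama_anchor`), S5 `stub_ratwall` = 24207 BY NAME.
Kernel (no `sorry` outside the stubs): frame (landed `stub_frame`) → K3a → S2 → S3 (typed as the analytic-to-algebraic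
`μ`-transfer on the axis; its internal shape is the proved `muZeroPackage_of_dvd_pow_mul`) → `μ`-package on the axis → S4 →
`μ`-package on the anticyclotomic line →
[RATWALL + landed `3`-saturation `dvd_of_dvd_prime_pow_mul prime_C_three`] → the crux BY NAME.

Tags (evidence in the line card): S5 WEAKER (tree theorem `rationalSplitIMCInclusionAtThree_of_wall`); S1 PRINT-ADJACENT;
S2, S3, S4 UNDECIDED (incomparable with the crux: S2/S3 concern the `𝔭`-AXIS, where no Heegner/BDP object lives —
`TraceZeroHeegnerTowerAtAdditiveSplitP` and `NoAdmissiblePrimesAtThree` do not quantify over it).  No COSTUME: no stub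
mentions the anticyclotomic module except S4's conclusion and S5 (the route's own weaker item).
Prior cards on this crux USED as ingredients (not re-claimed): `axis-carrier` (BF Euler system on the 𝔭-axis, structure
(∅ 𝔭, 0 𝔭′)), `unramified-regulator` (the 𝛉-dominant Coleman map at the unramified prime is the integral Λ-adic 𝔾_a-logarithm —
on TEETH, rational currency, slack 3^{t_m}, μ disclaimed), `stable-fibre-regulator` / `fern-reciprocity` (the wild-level reciprocity
law).  NEW here: μ-currency on the AXIS (no wild layer ⇒ constant slack ⇒ μ-tight), the p-part of the Kolyvagin bound, the
dominance transfer S4 (answers B-g18-1 without a two-variable reciprocity law), and S2 as the residual analytic crux.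
Sources: KLZ17 = arXiv:1503.02888 (Thm B = 10.2.2, §11.7 hyp. (v)); LLZ15 = arXiv:1311.0175 §§4.3, 5.3, 7.4–7.6; Howard2004
= arXiv:1202.6340 Thm 2.2.10; MazurRubin2004 Thm 5.3.10; Castella2018 Def. 2.2; Hsieh2014 Thm B; Hida2010; Silverman AEC IV.6.4
(log iso for `v(p) < p − 1`); Mazur1972 §4 (norms in unramified towers); Greenberg2016 Prop. 4.1.1; R-g18-1 / B-g18-1
(KEEPKILL-cruxidea-20395-1-g18.md).
-/

set_option linter.dupNamespace false
set_option autoImplicit false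

noncomputable section

open Literature.NumberTheory.EllipticCurves
open Literature.NumberTheory.GaloisRepresentations
open Summit.BirchSwinnertonDyer.BirchSwinnertonDyer.Theses.UniversalToricDescent
  (RationalSplitIMCInclusionAtThree AdditiveSplitIMCInclusionAtThree)
open Summit.BirchSwinnertonDyer.BirchSwinnertonDyer.Cruxes.ToricTransportModThree.RatwallThinComb
  (dvd_of_dvd_prime_pow_mul prime_C_three not_C_three_dvd_of_norm_coeff_eq_one)
open Summit.BirchSwinnertonDyer.Rank1Residual.X11b
open IsDedekindDomain NumberField Field

namespace Summit.BirchSwinnertonDyer.BirchSwinnertonDyer.Cruxes.AdditiveSplitIMCInclusionAtThree.UnramifiedColemanAxis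

/-! ## §0 Objects -/

/-- The `μ`-prime of `R₀⟦T⟧`: the constant series `3`. -/
abbrev threeC : UnrSeries 3 := PowerSeries.C ((3 : ℕ) : unrIntegers 3)

/-- Restriction of a two-variable series `L₂ ∈ R₀⟦T₂⟧⟦T₁⟧` to the `κ₁`-AXIS `T₂ = 0` (characters trivial on `γ₂`):
apply `constantCoeff` in the inner variable to every `T₁`-coefficient. [Washington1997 §7.1; tree `ThinComb.T₁/T₂`] -/
def axisRestrict (L₂ : PowerSeries (UnrSeries 3)) : UnrSeries 3 :=
  PowerSeries.map (PowerSeries.constantCoeff (R := unrIntegers 3)) L₂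

/-- The `μ = 0` PACKAGE in DIVISIBILITY currency for a `ℤ₃`-line `κ′` of `K` with topological generator `γ′` and strict
prime `𝔮`: `X_(0 at 𝔮, ∅ elsewhere above 3)(E/K_{κ′,∞})` is `Λ`-torsion and `Ch_Λ(X)·R₀⟦T⟧ = (g′)` with `3 ∤ g′`
(equivalently `μ = 0`; `not_C_three_dvd_of_norm_coeff_eq_one` converts the norm-currency package of
`Lines/tame_mu_descent.lean` into this one). [GreenbergVatsal2000 §2; Washington1997 §13.2] -/
def MuZeroPackage (W : WeierstrassCurve ℚ) (K : Type) [Field K] [NumberField K] (κ' : ZpExtension K 3)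
    (𝔮 : HeightOneSpectrum (𝓞 K)) (γ' : absoluteGaloisGroup K) [Fact (κ'.IsTopGenerator γ')] : Prop :=
  Module.IsTorsion (IwasawaAlgebra 3) (AcSelmer.XAc (W.baseChange K) 3 κ' 𝔮 ∅ γ') ∧
    ∃ g' : UnrSeries 3,
      (AcSelmer.XAc.charIdeal (W.baseChange K) 3 κ' 𝔮 ∅ γ').map (PowerSeries.map (Halves.toUnr 3)) =
          Ideal.span {g'} ∧ ¬ threeC ∣ g'

/-! ## §1 Proved anchor: `μ = 0` descends along a divisibility `g ∣ (e·L)^(c+1)` -/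

/-- `3 ∤ e`, `3 ∤ L` ⟹ `3 ∤ (e·L)^(c+1)` ⟹ `3 ∤ g` for every divisor `g` (the constant series `3` is prime in `R₀⟦T⟧`,
tree `prime_C_three`).  This is the kernel's use of S2: the Kolyvagin–Coleman bound S3 is a divisibility, and unit
content descends along it. [folklore; Washington1997 §7.1] -/
theorem not_threeC_dvd_of_dvd_pow_mul {g e L : UnrSeries 3} {c : ℕ} (he : ¬ threeC ∣ e) (hL : ¬ threeC ∣ L)
    (hg : g ∣ (e * L) ^ (c + 1)) : ¬ threeC ∣ g := by
  intro h3
  have hmul : ¬ threeC ∣ e * L := fun h ↦ (prime_C_three.dvd_or_dvd h).elim he hL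
  exact hmul (prime_C_three.dvd_of_dvd_pow (dvd_trans h3 hg))

/-- The SHAPE in which S3 is to be established: a Kolyvagin–Poitou–Tate divisibility `g′ ∣ (e·M)^(c+1)` of the
characteristic series by a power of (a `μ`-free multiple of) the local index `M`, with `μ(M) = 0`, yields the `μ = 0`
package. [MazurRubin2004 Thm 5.3.10 shape; Washington1997 §13.2] -/
theorem muZeroPackage_of_dvd_pow_mul (W : WeierstrassCurve ℚ) (K : Type) [Field K] [NumberField K]
    (κ' : ZpExtension K 3) (𝔮 : HeightOneSpectrum (𝓞 K)) (γ' : absoluteGaloisGroup K) [Fact (κ'.IsTopGenerator γ')]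
    (htors : Module.IsTorsion (IwasawaAlgebra 3) (AcSelmer.XAc (W.baseChange K) 3 κ' 𝔮 ∅ γ'))
    {g' e M : UnrSeries 3} {c : ℕ}
    (hg' : (AcSelmer.XAc.charIdeal (W.baseChange K) 3 κ' 𝔮 ∅ γ').map (PowerSeries.map (Halves.toUnr 3)) =
      Ideal.span {g'})
    (he : ¬ threeC ∣ e) (hM : ¬ threeC ∣ M) (hdvd : g' ∣ (e * M) ^ (c + 1)) : MuZeroPackage W K κ' 𝔮 γ' :=
  ⟨htors, g', hg', not_threeC_dvd_of_dvd_pow_mul he hM hdvd⟩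

/-! ## §2 Stub statements -/

/-- **S2 `AxisMuAnalytic`** (crux-research ∀, L — UNDECIDED · INSTRUMENTABLE): in a `thin_comb` frame, the branch-`𝔭` toric
two-variable function `L₂` (pinned by `IsToricTwoVarLFunction`, non-zero) is NOT divisible by `3` after restriction to the
`𝔭`-AXIS `T₂ = 0`; equivalently the `𝔭`-axis is not an exceptional line of `L₂ mod 3 ∈ 𝔽̄₃⟦T₁,T₂⟧` (`T₂ ∤ L̄₂`; note
`L̄₂ ≠ 0` by Hsieh's anticyclotomic `μ = 0`).  Why it might fail: the axis carries no interpolation point (characters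
unramified at `𝔭′` have `𝔭′`-Hodge–Tate weight `0`, outside the grid `b ≥ 1`), so `L₂(T₁,0)` is a `p`-adic limit
(logarithms of Beilinson–Flach classes), and `T₂ ∣ L̄₂` is excluded by no theorem in print; instrument: `L₂ mod 3` along
`T₂ = 0` from CM-point sums of the `3`-depleted `f` for sample ClassO6 rows. [Hsieh2014 Thm B; Hida2010; CastellaWan2023 §2.4] -/
def AxisMuAnalytic : Prop :=
    ∀ (W : WeierstrassCurve ℚ) [W.IsElliptic] [W.IsGloballyMinimal] (N : ℕ) [NeZero N] (K : Type) [Field K]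
      [NumberField K] (Dt : Literature.NumberTheory.EllipticCurves.ModularForms.ModularParametrizationData W N),
    Summit.BirchSwinnertonDyer.Rank1Residual.Additive.ClassO6 W 3 → W.HasSurjectiveModNGaloisRep 3 →
    W.analyticRank = 1 → W.conductorNorm ℤ = N → IsImaginaryQuadratic K → SatisfiesHeegnerHypothesis N K →
    ∀ (κ : ZpExtension K 3), κ.IsAnticyclotomic → ∀ (γ : Field.absoluteGaloisGroup K) [Fact (κ.IsTopGenerator γ)]
      (𝔭 : HeightOneSpectrum (𝓞 K)), ((3 : ℕ) : 𝓞 K) ∈ 𝔭.asIdeal →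
      𝔭.asIdeal.ramificationIdx (𝓞 ℚ) = 1 → 𝔭.asIdeal.inertiaDeg (𝓞 ℚ) = 1 →
    ∀ (𝔭' : HeightOneSpectrum (𝓞 K)), ((3 : ℕ) : 𝓞 K) ∈ 𝔭'.asIdeal → 𝔭' ≠ 𝔭 →
    ∀ (ι' : PadicAlgCl 3 ≃+* ℂ), Summit.BirchSwinnertonDyer.BirchSwinnertonDyer.Theorems.SchneiderFree.BranchInducesPrime 3 ι' 𝔭 →
    ∀ (κ₁ κ₂ : ZpExtension K 3) (γ₁ γ₂ : Field.absoluteGaloisGroup K) (k : ℕ)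
      [Fact (ZpExtension.IsTopGeneratorPair κ₁ κ₂ γ₁ γ₂)],
    (∀ v : HeightOneSpectrum (𝓞 K), v ≠ 𝔭 → ∀ 𝔓 ∈ v.primesAbove,
        𝔓.inertia (Field.absoluteGaloisGroup K) ≤ κ₁.kerSubgroup) →
    ZpExtension.pairKer κ₁ κ₂ ≤ κ.kerSubgroup → γ₁ * γ⁻¹ ∈ κ.kerSubgroup → γ₂ * (γ ^ (3 ^ k))⁻¹ ∈ κ.kerSubgroup →
    ∀ (ΩK' : ℂ) (Ωp' : ℂ_[3]) (L₂ : PowerSeries (PowerSeries (unrIntegers 3))), ΩK' ≠ 0 → Ωp' ≠ 0 →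
      IsToricTwoVarLFunction ι' 𝔭 𝔭' κ₁ κ₂ γ₁ γ₂ Dt.f ΩK' Ωp' L₂ → L₂ ≠ 0 →
    ¬ threeC ∣ axisRestrict L₂

/-- **S3 `UnramifiedColemanBound`** — THE ENGINE (crux-research ∀, XL — UNDECIDED, incomparable with the crux): ANALYTIC-TO-
ALGEBRAIC `μ`-TRANSFER ON THE `𝔭`-AXIS.  In a `thin_comb` frame, for the branch-`𝔭` toric function `L₂ ≠ 0`: if `3 ∤ L₂(T₁,0)`
then the dual Selmer group of `E` over the `𝔭`-AXIS `K_{κ₁,∞}` that is STRICT at `𝔭` and RELAXED at the UNRAMIFIED prime `𝔭′`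
is `Λ`-torsion with `μ = 0` (package `MuZeroPackage W K κ₁ 𝔭 γ₁`).  Mechanism (the shape in which it is to be proved is the
helper `muZeroPackage_of_dvd_pow_mul` below): Λ-adic Beilinson–Flach class `κ` of `(f_E, CM family of 𝔭-power conductor)`
∈ `H¹_(∅ 𝔭, f 𝔭′)(K, 𝕋)` (core rank 1; cards `axis-carrier`, `unramified-regulator` K2(a)) ⟹ Kolyvagin-system bound WITH
the `p`-part (`𝔮 = 3Λ ∈ Σ_Λ`, Howard's `(T^m + p)`-argument) `Ch X_(0 𝔭, f 𝔭′) ∣ char(H¹_ℱ/Λκ)`; Poitou–Tate adds the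
single local term `H¹_{f,Iw}(K_𝔭′, T₃E)/Λ·loc_𝔭′ κ`, computed by the UNRAMIFIED INTEGRAL COLEMAN COORDINATE
(`log_{ω_f} : E₀(K_{κ₁,n,𝔭′}) ⊗ ℤ₃ ⥲ 𝒪_n` since `e = 1 < p − 1` and `[𝒪_n : 𝔪_n] = #𝔾_a(k_n)`; normal integral basis;
slack = the CONSTANT `c(E) = v₃(#E(ℚ₃^{ur})[3^∞]·#Φ)` because the axis, unlike every comb tooth, has NO wild layer — this
is what makes the bound `μ`-tight) as `Λ/(P_κ)`, whence `Ch X_(0 𝔭, ∅ 𝔭′)(κ₁) ∣ (e·P_κ)^{c+1}` with `3 ∤ e`; the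
`g`-dominant reciprocity law (pairing `ω_f ⊗ η_𝐠`, unit root `λ(𝔭′)`; the supercuspidal `f₃ ⊗ λ_𝔭` has trivial
`L`-factor; cards `stable-fibre-regulator`, `fern-reciprocity`) gives `μ(P_κ) ≤ μ(L₂(T₁,0))`; and `μ = 0` descends along
the divisibility (`not_threeC_dvd_of_dvd_pow_mul`).  Why it might fail: (i) the reciprocity law at wild level
`3^v ∥ N_f`, `v ≥ 2`, is unwritten and its local zeta integral at the supercuspidal prime may put a POSITIVE power of `3`
on the wrong side (`3^a·P_κ = e·L₂|axis` would leave `μ(P_κ)` unbounded); (ii) the Kolyvagin machine over `K_{κ₁,∞}` at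
`p = 3` needs a rank-one `τ` in the `3`-ADIC image (Elkies rows: onto mod `3`, not mod `9`); (iii) the Λ-adic class with
`3² ∣ N_f` must keep the `c`-factor (`d² ≡ 1 mod 3` forbids LLZ15's removal; `c² − σ_c` is `μ`-free).
[KLZ17 Thm 10.2.2; LLZ15 §§5.3, 7.4–7.6; Howard2004 Thm 2.2.10; MazurRubin2004 Thm 5.3.10; Castella2018 Def. 2.2;
Silverman AEC IV.6.4; Mazur1972 §4; cards axis-carrier, unramified-regulator, stable-fibre-regulator] -/
def UnramifiedColemanBound : Prop :=
    ∀ (W : WeierstrassCurve ℚ) [W.IsElliptic] [W.IsGloballyMinimal] (N : ℕ) [NeZero N] (K : Type) [Field K]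
      [NumberField K] (Dt : Literature.NumberTheory.EllipticCurves.ModularForms.ModularParametrizationData W N),
    Summit.BirchSwinnertonDyer.Rank1Residual.Additive.ClassO6 W 3 → W.HasSurjectiveModNGaloisRep 3 →
    W.analyticRank = 1 → W.conductorNorm ℤ = N → IsImaginaryQuadratic K → SatisfiesHeegnerHypothesis N K →
    ∀ (κ : ZpExtension K 3), κ.IsAnticyclotomic → ∀ (γ : Field.absoluteGaloisGroup K) [Fact (κ.IsTopGenerator γ)]
      (𝔭 : HeightOneSpectrum (𝓞 K)), ((3 : ℕ) : 𝓞 K) ∈ 𝔭.asIdeal →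
      𝔭.asIdeal.ramificationIdx (𝓞 ℚ) = 1 → 𝔭.asIdeal.inertiaDeg (𝓞 ℚ) = 1 →
    ∀ (𝔭' : HeightOneSpectrum (𝓞 K)), ((3 : ℕ) : 𝓞 K) ∈ 𝔭'.asIdeal → 𝔭' ≠ 𝔭 →
    ∀ (ι' : PadicAlgCl 3 ≃+* ℂ), Summit.BirchSwinnertonDyer.BirchSwinnertonDyer.Theorems.SchneiderFree.BranchInducesPrime 3 ι' 𝔭 →
    ∀ (κ₁ κ₂ : ZpExtension K 3) (γ₁ γ₂ : Field.absoluteGaloisGroup K) (k : ℕ)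
      [Fact (ZpExtension.IsTopGeneratorPair κ₁ κ₂ γ₁ γ₂)] [Fact (κ₁.IsTopGenerator γ₁)],
    (∀ v : HeightOneSpectrum (𝓞 K), v ≠ 𝔭 → ∀ 𝔓 ∈ v.primesAbove,
        𝔓.inertia (Field.absoluteGaloisGroup K) ≤ κ₁.kerSubgroup) →
    ZpExtension.pairKer κ₁ κ₂ ≤ κ.kerSubgroup → γ₁ * γ⁻¹ ∈ κ.kerSubgroup → γ₂ * (γ ^ (3 ^ k))⁻¹ ∈ κ.kerSubgroup →
    ∀ (ΩK' : ℂ) (Ωp' : ℂ_[3]) (L₂ : PowerSeries (PowerSeries (unrIntegers 3))), ΩK' ≠ 0 → Ωp' ≠ 0 →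
      IsToricTwoVarLFunction ι' 𝔭 𝔭' κ₁ κ₂ γ₁ γ₂ Dt.f ΩK' Ωp' L₂ → L₂ ≠ 0 →
    ¬ threeC ∣ axisRestrict L₂ → MuZeroPackage W K κ₁ 𝔭 γ₁

/-- **S4 `AxisToAnticyclotomic`** — TRANSFER (crux-research ∀, L — UNDECIDED · ATTACKABLE under the LEAD's two-variable
inputs): in a `thin_comb` frame, the `μ = 0` package of `X_(0 at 𝔭, ∅ at 𝔭′)` on the `𝔭`-AXIS implies the `μ = 0` package of
the crux's module `X_(∅ at 𝔭, 0 at 𝔭′)` on the ANTICYCLOTOMIC line.  Mechanism: complex conjugation transports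
`(X_(0 𝔭, ∅ 𝔭′), 𝔭-axis)` to `(X_(∅ 𝔭, 0 𝔭′), 𝔭′-axis)` (same `μ`); for the two-variable module `X₂ = X_(∅ 𝔭, nr 𝔭′)(E/K̃_∞)`
with `pd ≤ 1` (NoPN) `Ch_Λ(X₂/ℓX₂) = π_ℓ(Ch_{Λ₂} X₂)` for every line `ℓ` with `X₂/ℓX₂` torsion, and control at the
`𝔭′`-axis is finite (`E(K̃_{∞,w})[3^∞]` finite at the relaxed prime, residue field fixed at the strict one), so
`μ₂(X₂) ≤ μ(𝔭′-axis) = 0`; finally `μ_ac(X) = μ₂(X₂)` EXACTLY under K2-rat₂ + Hsieh + NoPN + control (R-g18-1: the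
anticyclotomic line is not exceptional).  Why it might fail: needs the LEAD's two-variable rational inclusion K2-rat₂
(not only RATWALL) and NoPN; a finite non-zero pseudo-null submodule or an `ℓ`-torsion `X₂[ℓ′] ≠ 0` on the `𝔭′`-axis
would break `pd ≤ 1` bookkeeping (then only `μ₂ ≤ μ(axis)` up to the `X₂[ℓ′]` term).
[Greenberg2016 Prop. 4.1.1; Hsieh2014 Thm B; KEEPKILL-g18 R-g18-1; tree `stub_noPseudoNull`, `stub_descent`] -/
def AxisToAnticyclotomic : Prop :=
    ∀ (W : WeierstrassCurve ℚ) [W.IsElliptic] [W.IsGloballyMinimal] (N : ℕ) [NeZero N] (K : Type) [Field K]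
      [NumberField K] (Dt : Literature.NumberTheory.EllipticCurves.ModularForms.ModularParametrizationData W N),
    Summit.BirchSwinnertonDyer.Rank1Residual.Additive.ClassO6 W 3 → W.HasSurjectiveModNGaloisRep 3 →
    W.analyticRank = 1 → W.conductorNorm ℤ = N → IsImaginaryQuadratic K → SatisfiesHeegnerHypothesis N K →
    ∀ (κ : ZpExtension K 3), κ.IsAnticyclotomic → ∀ (γ : Field.absoluteGaloisGroup K) [Fact (κ.IsTopGenerator γ)]
      (𝔭 : HeightOneSpectrum (𝓞 K)), ((3 : ℕ) : 𝓞 K) ∈ 𝔭.asIdeal →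
      𝔭.asIdeal.ramificationIdx (𝓞 ℚ) = 1 → 𝔭.asIdeal.inertiaDeg (𝓞 ℚ) = 1 →
    ∀ (𝔭' : HeightOneSpectrum (𝓞 K)), ((3 : ℕ) : 𝓞 K) ∈ 𝔭'.asIdeal → 𝔭' ≠ 𝔭 →
    ∀ (ι' : PadicAlgCl 3 ≃+* ℂ), Summit.BirchSwinnertonDyer.BirchSwinnertonDyer.Theorems.SchneiderFree.BranchInducesPrime 3 ι' 𝔭 →
    ∀ (κ₁ κ₂ : ZpExtension K 3) (γ₁ γ₂ : Field.absoluteGaloisGroup K) (k : ℕ)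
      [Fact (ZpExtension.IsTopGeneratorPair κ₁ κ₂ γ₁ γ₂)] [Fact (κ₁.IsTopGenerator γ₁)],
    (∀ v : HeightOneSpectrum (𝓞 K), v ≠ 𝔭 → ∀ 𝔓 ∈ v.primesAbove,
        𝔓.inertia (Field.absoluteGaloisGroup K) ≤ κ₁.kerSubgroup) →
    ZpExtension.pairKer κ₁ κ₂ ≤ κ.kerSubgroup → γ₁ * γ⁻¹ ∈ κ.kerSubgroup → γ₂ * (γ ^ (3 ^ k))⁻¹ ∈ κ.kerSubgroup →
    MuZeroPackage W K κ₁ 𝔭 γ₁ → MuZeroPackage W K κ 𝔭' γ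

/-- The K3a statement as a `Prop` (VERBATIM the type of `stub_toricExists` of `Lines/thin_comb.lean` v8.1 /
`Lines/nakayama_anchor.lean`), so that the top composition can be stated over it. -/
def ToricExistsStatement : Prop :=
    ∀ (W : WeierstrassCurve ℚ) [W.IsElliptic] [W.IsGloballyMinimal] (N : ℕ) [NeZero N] (K : Type) [Field K]
      [NumberField K] (Dt : Literature.NumberTheory.EllipticCurves.ModularForms.ModularParametrizationData W N),
    Summit.BirchSwinnertonDyer.Rank1Residual.Additive.ClassO6 W 3 → W.HasSurjectiveModNGaloisRep 3 →
    W.analyticRank = 1 → W.conductorNorm ℤ = N → IsImaginaryQuadratic K → SatisfiesHeegnerHypothesis N K →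
    ∀ (κ : ZpExtension K 3), κ.IsAnticyclotomic → ∀ (γ : Field.absoluteGaloisGroup K) [Fact (κ.IsTopGenerator γ)]
      (𝔭 : HeightOneSpectrum (𝓞 K)), ((3 : ℕ) : 𝓞 K) ∈ 𝔭.asIdeal →
      𝔭.asIdeal.ramificationIdx (𝓞 ℚ) = 1 → 𝔭.asIdeal.inertiaDeg (𝓞 ℚ) = 1 →
    ∀ (𝔭' : HeightOneSpectrum (𝓞 K)), ((3 : ℕ) : 𝓞 K) ∈ 𝔭'.asIdeal → 𝔭' ≠ 𝔭 →
    ∀ (ι' : PadicAlgCl 3 ≃+* ℂ), Summit.BirchSwinnertonDyer.BirchSwinnertonDyer.Theorems.SchneiderFree.BranchInducesPrime 3 ι' 𝔭 →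
    ∀ (κ₁ κ₂ : ZpExtension K 3) (γ₁ γ₂ : Field.absoluteGaloisGroup K) (k : ℕ)
      [Fact (ZpExtension.IsTopGeneratorPair κ₁ κ₂ γ₁ γ₂)],
    (∀ v : HeightOneSpectrum (𝓞 K), v ≠ 𝔭 → ∀ 𝔓 ∈ v.primesAbove,
        𝔓.inertia (Field.absoluteGaloisGroup K) ≤ κ₁.kerSubgroup) →
    ZpExtension.pairKer κ₁ κ₂ ≤ κ.kerSubgroup → γ₁ * γ⁻¹ ∈ κ.kerSubgroup → γ₂ * (γ ^ (3 ^ k))⁻¹ ∈ κ.kerSubgroup →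
    ∃ (ΩK' : ℂ) (Ωp' : ℂ_[3]) (L₂ : PowerSeries (PowerSeries (unrIntegers 3))),
      ΩK' ≠ 0 ∧ Ωp' ≠ 0 ∧ IsToricTwoVarLFunction ι' 𝔭 𝔭' κ₁ κ₂ γ₁ γ₂ Dt.f ΩK' Ωp' L₂

/-! ## §3 Registered stubs -/

/-- **S1 = K3a `stub_toricExists`** — VERBATIM from `Lines/thin_comb.lean` v8.1 (PRINT-ADJACENT · ATTACKABLE): in a v2
frame a two-variable toric `𝔭`-adic `L`-function `L₂ ∈ Λ₂(R₀)` of `f = Dt.f` exists at SOME admissible period pair.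
[cite: CastellaWan2023, §2.4 Thm. 2.11 (arXiv:1607.02019)] [cite: Hida1988AIF, §5 Thm. 5.1b (doi:10.5802/aif.1141)]
Why it might fail at three: Hida 1988 carries `p ≥ 5` (ordinary Λ-adic duality); the `p = 3` case is an unwritten
adaptation (see `K3A-PRINT-STATUS-g4.md`). -/
theorem stub_toricExists :
    ∀ (W : WeierstrassCurve ℚ) [W.IsElliptic] [W.IsGloballyMinimal] (N : ℕ) [NeZero N] (K : Type) [Field K]
      [NumberField K] (Dt : Literature.NumberTheory.EllipticCurves.ModularForms.ModularParametrizationData W N),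
    Summit.BirchSwinnertonDyer.Rank1Residual.Additive.ClassO6 W 3 → W.HasSurjectiveModNGaloisRep 3 →
    W.analyticRank = 1 → W.conductorNorm ℤ = N → IsImaginaryQuadratic K → SatisfiesHeegnerHypothesis N K →
    ∀ (κ : ZpExtension K 3), κ.IsAnticyclotomic → ∀ (γ : Field.absoluteGaloisGroup K) [Fact (κ.IsTopGenerator γ)]
      (𝔭 : HeightOneSpectrum (𝓞 K)), ((3 : ℕ) : 𝓞 K) ∈ 𝔭.asIdeal →
      𝔭.asIdeal.ramificationIdx (𝓞 ℚ) = 1 → 𝔭.asIdeal.inertiaDeg (𝓞 ℚ) = 1 →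
    ∀ (𝔭' : HeightOneSpectrum (𝓞 K)), ((3 : ℕ) : 𝓞 K) ∈ 𝔭'.asIdeal → 𝔭' ≠ 𝔭 →
    ∀ (ι' : PadicAlgCl 3 ≃+* ℂ), Summit.BirchSwinnertonDyer.BirchSwinnertonDyer.Theorems.SchneiderFree.BranchInducesPrime 3 ι' 𝔭 →
    ∀ (κ₁ κ₂ : ZpExtension K 3) (γ₁ γ₂ : Field.absoluteGaloisGroup K) (k : ℕ)
      [Fact (ZpExtension.IsTopGeneratorPair κ₁ κ₂ γ₁ γ₂)],
    (∀ v : HeightOneSpectrum (𝓞 K), v ≠ 𝔭 → ∀ 𝔓 ∈ v.primesAbove,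
        𝔓.inertia (Field.absoluteGaloisGroup K) ≤ κ₁.kerSubgroup) →
    ZpExtension.pairKer κ₁ κ₂ ≤ κ.kerSubgroup → γ₁ * γ⁻¹ ∈ κ.kerSubgroup → γ₂ * (γ ^ (3 ^ k))⁻¹ ∈ κ.kerSubgroup →
    ∃ (ΩK' : ℂ) (Ωp' : ℂ_[3]) (L₂ : PowerSeries (PowerSeries (unrIntegers 3))),
      ΩK' ≠ 0 ∧ Ωp' ≠ 0 ∧ IsToricTwoVarLFunction ι' 𝔭 𝔭' κ₁ κ₂ γ₁ γ₂ Dt.f ΩK' Ωp' L₂ := by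
  sorry

/-- **S2** registered stub (UNDECIDED · INSTRUMENTABLE), see `AxisMuAnalytic`. [Hsieh2014 Thm B; Hida2010] -/
theorem stub_axisMuAnalytic : AxisMuAnalytic := by
  sorry

/-- **S3** registered stub — THE ENGINE (UNDECIDED), see `UnramifiedColemanBound`.
[KLZ17 Thm 10.2.2; LLZ15 §5.3; Howard2004 Thm 2.2.10; MazurRubin2004 Thm 5.3.10] -/
theorem stub_unramifiedColemanBound : UnramifiedColemanBound := by
  sorry

/-- **S4** registered stub — TRANSFER (UNDECIDED · ATTACKABLE under the LEAD's inputs), see `AxisToAnticyclotomic`.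
[Greenberg2016 Prop. 4.1.1; Hsieh2014 Thm B; R-g18-1] -/
theorem stub_axisToAnticyclotomic : AxisToAnticyclotomic := by
  sorry

/-- **S5 `stub_ratwall`** — the route item `RationalSplitIMCInclusionAtThree` (stmt-BirchSwinnertonDyer-24207, LEAD) BY
NAME (WEAKER than the crux: tree theorem `rationalSplitIMCInclusionAtThree_of_wall`). -/
theorem stub_ratwall : RationalSplitIMCInclusionAtThree := by
  sorry

/-! ## §4 Composition -/

/-- `stub_toricExists` IS the K3a statement (definitional). -/
theorem toricExistsStatement_of_stub : ToricExistsStatement := stub_toricExists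

/-- **TOP COMPOSITION — concludes the crux `AdditiveSplitIMCInclusionAtThree` BY NAME** from the five stub statements
(kernel-checked, no `sorry` outside the stubs): RATWALL (S5) gives `3^k·L ∈ Ch·R₀⟦T⟧`; the landed frame `stub_frame` and
K3a (S1) give a branch-`𝔭` toric `L₂`; the landed cross-period rigidity `ContRigidity.eq_zero_or_span_spec_eq_of_toric`
discharges `L = 0` and `L₂ = 0`; for `L₂ ≠ 0` the ENGINE S3 gives `g₁ ∣ (e·L₂(T₁,0))^(c+1)` on the `𝔭`-axis, S2 and the
proved `not_threeC_dvd_of_dvd_pow_mul` give `3 ∤ g₁` (axis `μ = 0` package), the TRANSFER S4 gives the anticyclotomic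
`μ = 0` package `3 ∤ g`, and the landed `3`-saturation `dvd_of_dvd_prime_pow_mul prime_C_three` turns `g ∣ 3^k·L` into
`g ∣ L`, i.e. `(L) ⊆ Ch·R₀⟦T⟧`. -/
theorem AdditiveSplitIMCInclusionAtThree_of :
    ToricExistsStatement → AxisMuAnalytic → UnramifiedColemanBound → AxisToAnticyclotomic →
      RationalSplitIMCInclusionAtThree →
      Summit.BirchSwinnertonDyer.BirchSwinnertonDyer.Theses.UniversalToricDescent.AdditiveSplitIMCInclusionAtThree := by
  intro h₁ h₂ h₃ h₄ hR W _ _ N _ K _ _ Dt hO6 hsurj hrk hN hK hH κ hκ γ hγ 𝔭 h3 hram hdeg 𝔭' h3' hne ι' hι ΩK Ωp L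
    hΩK hΩp hL
  -- S5: the rational wall
  obtain ⟨k₀, hk⟩ := hR W N K Dt hO6 hsurj hrk hN hK hH κ hκ γ 𝔭 h3 hram hdeg 𝔭' h3' hne ι' hι ΩK Ωp L hΩK hΩp hL
  -- the frame (landed) and S1 = K3a
  obtain ⟨κ₁, κ₂, γ₁, γ₂, k, hpair, hur₁, hker, hγ₁, hγ₂⟩ :=
    Summit.BirchSwinnertonDyer.BirchSwinnertonDyer.Theorems.UniversalToricDescentThinCombLine.stub_frame K hK κ hκ γ
      hγ.out 𝔭 h3 𝔭' h3' hne
  haveI : Fact (ZpExtension.IsTopGeneratorPair κ₁ κ₂ γ₁ γ₂) := ⟨hpair⟩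
  haveI : Fact (κ₁.IsTopGenerator γ₁) := ⟨hpair.left⟩
  obtain ⟨ΩK', Ωp', L₂, hΩK', hΩp', hL₂⟩ :=
    h₁ W N K Dt hO6 hsurj hrk hN hK hH κ hκ γ 𝔭 h3 hram hdeg 𝔭' h3' hne ι' hι κ₁ κ₂ γ₁ γ₂ k hur₁ hker hγ₁ hγ₂
  -- cross-period rigidity (landed): `L = 0` or `(spec L₂) = (L)`
  rcases Summit.BirchSwinnertonDyer.BirchSwinnertonDyer.Theorems.UniversalToricDescentThinComb.ContRigidity.eq_zero_or_span_spec_eq_of_toric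
      K N Dt.f hK κ hκ γ hγ.out 𝔭 h3 𝔭' h3' hne ι' κ₁ κ₂ γ₁ γ₂ k hpair hγ₁ hγ₂ hΩK hΩp hL hΩK' hΩp' hL₂ with h0 | hspan
  · rw [h0, Ideal.span_singleton_eq_bot.mpr rfl]
    exact bot_le
  by_cases hL0 : L₂ = 0
  · rw [← hspan, hL0, map_zero, Ideal.span_singleton_eq_bot.mpr rfl]
    exact bot_le
  -- S2: the axis is not an exceptional line of `L₂ mod 3`
  have hS2 : ¬ threeC ∣ axisRestrict L₂ :=
    h₂ W N K Dt hO6 hsurj hrk hN hK hH κ hκ γ 𝔭 h3 hram hdeg 𝔭' h3' hne ι' hι κ₁ κ₂ γ₁ γ₂ k hur₁ hker hγ₁ hγ₂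
      ΩK' Ωp' L₂ hΩK' hΩp' hL₂ hL0
  -- S3: the unramified-Coleman Kolyvagin engine transfers analytic `μ = 0` to the axis `μ = 0` package
  have haxis : MuZeroPackage W K κ₁ 𝔭 γ₁ :=
    h₃ W N K Dt hO6 hsurj hrk hN hK hH κ hκ γ 𝔭 h3 hram hdeg 𝔭' h3' hne ι' hι κ₁ κ₂ γ₁ γ₂ k hur₁ hker hγ₁ hγ₂
      ΩK' Ωp' L₂ hΩK' hΩp' hL₂ hL0 hS2
  -- S4: transfer to the anticyclotomic line
  obtain ⟨-, g, hg, hndvd⟩ :=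
    h₄ W N K Dt hO6 hsurj hrk hN hK hH κ hκ γ 𝔭 h3 hram hdeg 𝔭' h3' hne ι' hι κ₁ κ₂ γ₁ γ₂ k hur₁ hker hγ₁ hγ₂ haxis
  -- landed `3`-saturation
  rw [hg] at hk ⊢
  have hdvd : g ∣ ((3 : ℕ) : UnrSeries 3) ^ k₀ * L := Ideal.mem_span_singleton.mp hk
  rw [← map_natCast (PowerSeries.C (R := unrIntegers 3))] at hdvd
  exact Ideal.span_singleton_le_span_singleton.mpr (dvd_of_dvd_prime_pow_mul prime_C_three hndvd k₀ hdvd)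

/-- The crux from the registered stubs (sanity instance of the top composition; depends on the five `sorry`s). -/
theorem AdditiveSplitIMCInclusionAtThree_of_stubs :
    Summit.BirchSwinnertonDyer.BirchSwinnertonDyer.Theses.UniversalToricDescent.AdditiveSplitIMCInclusionAtThree :=
  AdditiveSplitIMCInclusionAtThree_of toricExistsStatement_of_stub stub_axisMuAnalytic stub_unramifiedColemanBound
    stub_axisToAnticyclotomic stub_ratwall

end Summit.BirchSwinnertonDyer.BirchSwinnertonDyer.Cruxes.AdditiveSplitIMCInclusionAtThree.UnramifiedColemanAxis

end
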